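import Mathlib
import HarnessLib
import Literature.Analysis.FluidPDE.TypeIAncientMildTubeAnalyticity
import Literature.Analysis.Complex.HolomorphicFramesOfKernels
import Literature.Analysis.FunctionSpaces.TorusTrigPoly
import Summits.NavierStokesRegularity.NavierStokesRegularity.Theorems.UnthreadedDoorNetFluxDefs
import Summits.NavierStokesRegularity.NavierStokesRegularity.Theorems.TypeILiouvilleTypeIliouvilleLOseenGauge

/-!
# Route `UnthreadedDoor`, crux `PoloidalLiouville` (stmt-NavierStokesRegularity-1222), WALL W1 — LINE `height_head`, stub HH-0:
# spatial analyticity of smooth bounded ancient mild solutions (`HeightHead.NSSpatialAnalyticity`)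

The registered stub HH-0 `stub_nsSpatialAnalyticity : NSSpatialAnalyticity` of ns-idea-14's line
`Cruxes/PoloidalLiouville/Lines/height_head.lean` (crux write ceef24122338, l.496–499 / l.833), proved with its binders
VERBATIM (`nsSpatialAnalyticity`): a bounded ancient mild solution (duality form, `ν = 1`) with a.e.-strongly measurable
slices that is smooth on the open past slab has REAL-ANALYTIC velocity slices `v t` on all of `ℝ³`, for every `t < 0`.

It is an in-tree corollary (the line's recipe, followed literally):
* the Oseen gauge theorem `Theorems.oseen_gauge_of_aestronglyMeasurable` (crux `TypeIliouvilleL`): `v t = w t (· − A t) + c t`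
  a.e., with `w` continuous and uniformly bounded by `K` on the slab, weakly divergence free, pointwise Oseen-mild;
* Guberović 2010 / Bradshaw–Grujić–Kukavica 2016 Thm. 2.4.1, PROVED in the tree
  (`guberovic2010_analyticity_radius_holds.of_oseen_solution`), restarted from `s' = t − τ`,
  `τ = min (1/(2c₀²K̄²)) (−t)`, `K̄ = max K 1`, on the window `(s', t + τ/2) ⊂ (−∞, 0)` — verbatim the proof of
  `Literature.Analysis.FluidPDE.exists_tube_extension_of_typeI_ancient_mild` with the Type-I size replaced by the constant
  bound: `w t` is the restriction of a map holomorphic on a complex tube;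
* tube-holomorphic ⇒ real-analytic (`analyticOnNhd_of_tube_extension`: vector-valued Osgood
  `Literature.Analysis.Complex.analyticOnNhd_of_differentiableOn_of_finiteDimensional`, `restrictScalars`, composition with
  `complexify` and its left inverse `realPart`);
* both sides of the a.e. Galilean representation are continuous (the slice `v t` by the smoothness hypothesis), hence equal
  everywhere, and `x ↦ w t (x − A t) + c t` is real-analytic.

WHAT THIS IS NOT: no new NS estimate; `PoloidalLiouville` (1222), the height-head targets, W1 and NS regularity stay OPEN.
`--supports stmt-NavierStokesRegularity-1222 --as helper`.  [folklore]
-/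

noncomputable section

-- the summit and its single sub-problem share the name (CONVENTIONS §1)
set_option linter.dupNamespace false

open Set Function Filter Topology MeasureTheory Metric
open scoped ENNReal

namespace Summit.NavierStokesRegularity.NavierStokesRegularity.Theorems.PoloidalLiouville.NetFlux

open Literature.Analysis Literature.Analysis.FluidPDE
open Literature.Analysis.FunctionSpaces.EuclideanSpace (complexify complexify_apply norm_complexify
  continuous_complexify)

/-- **Tube-holomorphic slices are real-analytic.**  If `U : ℂ³ → ℂ³` is holomorphic on the tube `complexTube (Fin 3) r`,
`r > 0`, and `U (complexify x) = complexify (f x)` for all real `x`, then `f` is real-analytic on `ℝ³` (vector-valued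
Osgood, restriction of scalars, `f = realPart ∘ U ∘ complexify`). [folklore] -/
theorem analyticOnNhd_of_tube_extension {r : ℝ} (hr : 0 < r)
    {U : EuclideanSpace ℂ (Fin 3) → EuclideanSpace ℂ (Fin 3)} {f : E3 → E3}
    (hU : DifferentiableOn ℂ U (complexTube (Fin 3) r)) (hUf : ∀ x, U (complexify x) = complexify (f x)) :
    AnalyticOnNhd ℝ f (univ : Set E3) := by
  have hUan : AnalyticOnNhd ℂ U (complexTube (Fin 3) r) :=
    Literature.Analysis.Complex.analyticOnNhd_of_differentiableOn_of_finiteDimensional (isOpen_complexTube _) hU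
  intro x _
  have hcx : complexify x ∈ complexTube (Fin 3) r := complexify_mem_complexTube hr x
  have h1 : AnalyticAt ℝ (fun x' : E3 => U (complexify x')) x :=
    ((hUan _ hcx).restrictScalars (𝕜 := ℝ)).comp
      ((complexify : E3 →ₗᵢ[ℝ] EuclideanSpace ℂ (Fin 3)).toContinuousLinearMap.analyticAt x)
  have h2 : AnalyticAt ℝ (fun x' : E3 => FunctionSpaces.EuclideanSpace.realPart (U (complexify x'))) x :=
    ((FunctionSpaces.EuclideanSpace.realPart : EuclideanSpace ℂ (Fin 3) →L[ℝ] E3).analyticAt _).comp h1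
  have heq : (fun x' : E3 => FunctionSpaces.EuclideanSpace.realPart (U (complexify x'))) = f := by
    funext x'
    rw [hUf, FunctionSpaces.EuclideanSpace.realPart_complexify]
  rwa [heq] at h2

/-- **HH-0 `HeightHead.NSSpatialAnalyticity` (line `height_head` l.496–499), binders VERBATIM.**  A bounded ancient mild
solution (duality form, `ν = 1`) with a.e.-strongly measurable slices, smooth on `(−∞,0) × ℝ³`, has real-analytic slices
`v t` on `ℝ³` for every `t < 0`.  Oseen gauge + Guberović 2010 restarted just before `t` + tube holomorphy ⇒ analyticity +
continuity upgrade of the a.e. Galilean representation. [folklore] -/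
theorem nsSpatialAnalyticity :
    ∀ v : ℝ → E3 → E3, IsBoundedAncientMildSolution 1 v → (∀ t < 0, AEStronglyMeasurable (v t) volume) →
    ContDiffOn ℝ (⊤ : ℕ∞) (Function.uncurry v) (Iio 0 ×ˢ univ) →
    ∀ t < 0, AnalyticOnNhd ℝ (v t) (univ : Set E3) := by
  intro u hu hmeas hsmooth t ht
  obtain ⟨w, A, c, -, hwc, ⟨K, hK⟩, hwdiv, hwmild, -, hrep⟩ :=
    Theorems.oseen_gauge_of_aestronglyMeasurable u hu hmeas
  -- Guberović's theorem (proved fact) and the constants of the restart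
  obtain ⟨c₀, hc₀, hG⟩ := guberovic2010_analyticity_radius_holds.of_oseen_solution
  have hc₀0 : 0 < c₀ := one_pos.trans hc₀
  have hslice : ∀ s < 0, Continuous (w s) := fun s hs =>
    hwc.comp_continuous (Continuous.prodMk_right s) fun x => ⟨hs, mem_univ _⟩
  set Kb : ℝ := max K 1 with hKb
  have hKb1 : 1 ≤ Kb := le_max_right _ _
  have hKb0 : 0 < Kb := one_pos.trans_le hKb1
  have hKKb : K ≤ Kb := le_max_left _ _
  set τ : ℝ := min (1 / (2 * c₀ ^ 2 * Kb ^ 2)) (-t) with hτ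
  have hτ0 : 0 < τ := lt_min (by positivity) (neg_pos.2 ht)
  have hτt : τ ≤ -t := min_le_right _ _
  have hτc : τ ≤ 1 / (2 * c₀ ^ 2 * Kb ^ 2) := min_le_left _ _
  set s' : ℝ := t - τ with hs'
  set T₁ : ℝ := t + τ / 2 with hT₁
  have hs't : s' < t := by rw [hs']; linarith
  have hT₁0 : T₁ < 0 := by rw [hT₁]; linarith
  have htT₁ : t < T₁ := by rw [hT₁]; linarith
  have hs'0 : s' < 0 := hs't.trans ht
  have hwin : T₁ ≤ s' + 1 / (c₀ ^ 2 * Kb ^ 2) := by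
    have e : 1 / (c₀ ^ 2 * Kb ^ 2) = 2 * (1 / (2 * c₀ ^ 2 * Kb ^ 2)) := by
      field_simp
    rw [e, hT₁, hs']
    linarith
  -- the datum `w s'`
  have ha_meas : AEStronglyMeasurable (w s') volume := (hslice s' hs'0).aestronglyMeasurable
  have ha_bd : ∀ x, ‖w s' x‖ ≤ Kb := fun x => (hK s' hs'0 x).trans hKKb
  have ha_Linf : eLpNorm (w s') ∞ volume ≤ ENNReal.ofReal Kb := by
    rw [eLpNorm_exponent_top]
    exact eLpNormEssSup_le_of_ae_bound (Eventually.of_forall ha_bd)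
  have ha_div : IsWeaklyDivFree (w s') := hwdiv s' hs'0
  -- `w` on the window `(s', T₁)`
  have hw_meas : AEStronglyMeasurable (uncurry w)
      ((volume : Measure (ℝ × E3)).restrict (Ioo s' T₁ ×ˢ univ)) := by
    refine (hwc.mono (prod_mono (fun s hs => ?_) Subset.rfl)).aestronglyMeasurable
      (measurableSet_Ioo.prod MeasurableSet.univ)
    exact (hs.2.trans hT₁0 : s < 0)
  have hw_bd : ∀ s ∈ Ioo s' T₁, eLpNorm (w s) ∞ volume ≤ ENNReal.ofReal Kb := by
    intro s hs
    rw [eLpNorm_exponent_top]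
    exact eLpNormEssSup_le_of_ae_bound
      (Eventually.of_forall fun x => (hK s (hs.2.trans hT₁0) x).trans hKKb)
  have hw_eq : ∀ s ∈ Ioo s' T₁, w s =ᵐ[volume] fun x =>
      UnboundedOperators.heatExtension (w s') (1 * (s - s')) x - oseenDuhamel 1 s' w w s x := by
    intro s hs
    rw [one_mul]
    exact Eventually.of_forall fun x => hwmild s' s hs.1 (hs.2.trans hT₁0) x
  have hw_cont : ∀ s ∈ Ioo s' T₁, Continuous (w s) := fun s hs => hslice s (hs.2.trans hT₁0)
  -- the slice `w t` is tube-holomorphic, hence real-analytic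
  obtain ⟨U, hUd, hUv, -⟩ := hG one_pos s' hKb0 ha_meas ha_Linf ha_div (hs't.trans htT₁) hwin hKb0.le
    hw_meas hw_bd hw_eq hw_cont t ⟨hs't, htT₁⟩
  have hwan : AnalyticOnNhd ℝ (w t) (univ : Set E3) :=
    analyticOnNhd_of_tube_extension (guberovic2010_radius_pos hc₀0 one_pos hs't) hUd hUv
  -- the Galilean representation holds everywhere at time `t` (both sides are continuous)
  have hut : Continuous (u t) :=
    hsmooth.continuousOn.comp_continuous (Continuous.prodMk_right t) fun x => ⟨ht, mem_univ _⟩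
  have hrhs : Continuous fun x : E3 => w t (x - A t) + c t :=
    ((hslice t ht).comp (continuous_id.sub continuous_const)).add continuous_const
  have heq : u t = fun x => w t (x - A t) + c t :=
    (Continuous.ae_eq_iff_eq volume hut hrhs).1 (hrep t ht)
  rw [heq]
  intro x _
  exact ((hwan _ (mem_univ _)).comp (analyticAt_id.sub analyticAt_const)).add analyticAt_const

end Summit.NavierStokesRegularity.NavierStokesRegularity.Theorems.PoloidalLiouville.NetFlux
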